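import Summits.BirchSwinnertonDyer.BirchSwinnertonDyer.Theorems.GenusKolyvaginAtTwoEquivariantKolyvaginExactAtTwoLocalDualityOrder
import Summits.BirchSwinnertonDyer.Rank1Residual.Ordinary.SingularQuotientPairing
import Literature.NumberTheory.GaloisCohomology.ArchimedeanInvariantMap
import HarnessLib

/-!
# Route `GenusKolyvaginAtTwo`, crux L_T `PowDvdShaCardAtTwoRT` (stmt-BirchSwinnertonDyer-23242), LINE 18 stub L, bottom rung:
# (hF) THE LOCAL KUMMER CONDITION IS ITS OWN LEFT ANNIHILATOR OFF `p` — for any family `inv` injective at `v`, and for the canonical one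

LEAD seat `bsd-line-gk2-p1` g16 (cell `bsd-f1-sign2`), `--supports 23242 --as helper`.  THEOREMS ONLY; no `sorry`; standard axioms.
BSD is NOT proved by any of this; neither is the crux nor stub L.

WHY (memo `Cruxes/PowDvdShaCardAtTwoRT/Lines/plus-descent-lead-g16.md` §2, §10).  The `ℓ′`-glue `…RTBottomRungNewPrime.invWeilPairing_localization_ne_zero_of_newPrime`
displays (hF): `{}^⊥𝓛_{ℓ′} ≤ 𝓛_{ℓ′}` for `inv_{ℓ′}(· ∪ₑ ·)` on `H¹(ℚ_{ℓ′}, E[2^M])`.  The tree proves the EQUALITY `{}^⊥𝓛_v = 𝓛_v` at a finite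
place for an injective `inv_v` under Tate's count `#H¹(K_v, E[n]) = (#E(K_v)[n]·#(𝓞_v/n))²`
(`Rank1Residual.Ordinary.ReciprocityPT.annLeft_invWeilPairing_kummer_eq`), and proves that count off `p` unconditionally
(`GenusExact.LocalDualityOrder.hEuler_of_not_mem`, Milne I Thm. 2.8 / Lemma 2.9).  This file composes them:
* `annLeft_invWeilPairing_kummerSelmerStructure_eq_of_not_mem` — any number field `K`, level `p^k` (`k ≠ 0`), finite `v ∤ p`, `inv_v` injective;
* `annLeft_invWeilPairing_kummerSelmerStructure_eq_canonical` / `…_le_canonical` — the canonical Poitou–Tate family (`canonical_isPerfect`),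
  the form (hF) consumed by the bottom rung (`K = ℚ`, `p = 2`, `v = ℓ′ ≠ 2`).
Namespace `…Theorems.GenusExact.RelaxedCount`.  Closes nothing.  BSD is NOT proved by any of this.

References: [MilneADT2006] I Cor. 2.3, Thm. 2.8, Lemma 2.9, Cor. 3.4; [PoonenRains2012] Prop. 4.10; [McCallumLMS1991] §5 Lemma 5.3.
-/

set_option autoImplicit false
-- the Theorems namespace of this sub repeats the summit name by design (D-0017 nested layout)
set_option linter.dupNamespace false

noncomputable section

open scoped Classical

open Field NumberField IsDedekindDomain Function WeierstrassCurve
open Literature.NumberTheory.EllipticCurves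
open Literature.NumberTheory.GaloisRepresentations
open Literature.NumberTheory.GaloisCohomology
open Summit.BirchSwinnertonDyer.Rank1Residual.X11b.FiniteDuality
open Summit.BirchSwinnertonDyer.Rank1Residual.X11b.Relaxation
open Summit.BirchSwinnertonDyer.Rank1Residual.Ordinary.ReciprocityPT

namespace Summit.BirchSwinnertonDyer.BirchSwinnertonDyer.Theorems.GenusExact.RelaxedCount

variable {K : Type} [Field K] [NumberField K] (W : WeierstrassCurve K) [W.IsElliptic]
variable {p k : ℕ} [Fact p.Prime] [NeZero (p ^ k)]
variable (e : W.geomTorsion (p ^ k) → W.geomTorsion (p ^ k) → AlgebraicClosure K)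
  (hμ : ∀ S T, e S T ^ (p ^ k) = 1)
  (hadd₁ : ∀ S₁ S₂ T, e (S₁ + S₂) T = e S₁ T * e S₂ T)
  (hadd₂ : ∀ S T₁ T₂, e S (T₁ + T₂) = e S T₁ * e S T₂)
  (hgal : ∀ (σ : absoluteGaloisGroup K) (S T : W.geomTorsion (p ^ k)), σ • e S T = e (σ • S) (σ • T))
  (halt : ∀ T, e T T = 1) (hnondeg : ∀ T, (∀ S, e S T = 1) → T = 0)

include halt hnondeg in
/-- **`{}^⊥𝓛_v = 𝓛_v` off `p`.**  At a finite place `v ∤ p` of a number field, for the level `p^k` (`k ≠ 0`), an alternating non-degenerate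
Galois-equivariant Weil pairing `e` and ANY family `inv` with `inv_v` injective: the left annihilator of the Kummer group under `inv_v(· ∪ₑ ·)`
is the Kummer group (`annLeft_invWeilPairing_kummer_eq` + `hEuler_of_not_mem`). [cite: MilneADT2006, Ch. I, Cor. 3.4 and Lemma 2.9]
[cite: PoonenRains2012, Prop. 4.10] -/
theorem annLeft_invWeilPairing_kummerSelmerStructure_eq_of_not_mem (hk : k ≠ 0) (v : HeightOneSpectrum (𝓞 K))
    (hpv : (p : 𝓞 K) ∉ v.asIdeal) (inv : LocalInvariants K (p ^ k)) (hinv : Injective (inv (Sum.inr v))) :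
    annLeft (invWeilPairing W (p ^ k) e hμ hadd₁ hadd₂ hgal inv (Sum.inr v)) (W.kummerSelmerStructure ((p ^ k : ℕ) : ℤ) (Sum.inr v)) =
      W.kummerSelmerStructure ((p ^ k : ℕ) : ℤ) (Sum.inr v) :=
  annLeft_invWeilPairing_kummer_eq W (p ^ k) e hμ hadd₁ hadd₂ hgal halt hnondeg inv v hinv
    (LocalDualityOrder.hEuler_of_not_mem v W hk hpv)

include halt hnondeg in
/-- **`{}^⊥𝓛_v = 𝓛_v` off `p` for the canonical Poitou–Tate family** (`LocalInvariants.canonical`, bijective at the finite places by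
`canonical_isPerfect`). [cite: MilneADT2006, Ch. I, Cor. 2.3 and Cor. 3.4] -/
theorem annLeft_invWeilPairing_kummerSelmerStructure_eq_canonical (hk : k ≠ 0) (v : HeightOneSpectrum (𝓞 K))
    (hpv : (p : 𝓞 K) ∉ v.asIdeal) :
    annLeft (invWeilPairing W (p ^ k) e hμ hadd₁ hadd₂ hgal (LocalInvariants.canonical K (p ^ k)) (Sum.inr v))
        (W.kummerSelmerStructure ((p ^ k : ℕ) : ℤ) (Sum.inr v)) =
      W.kummerSelmerStructure ((p ^ k : ℕ) : ℤ) (Sum.inr v) :=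
  annLeft_invWeilPairing_kummerSelmerStructure_eq_of_not_mem W e hμ hadd₁ hadd₂ hgal halt hnondeg hk v hpv _
    ((LocalInvariants.canonical_isPerfect (K := K) (n := p ^ k)) v).1.1

include halt hnondeg in
/-- The inclusion form (hF) `{}^⊥𝓛_v ≤ 𝓛_v` consumed by `pairing_two_nsmul_ne_zero_of_lagrangian` /
`invWeilPairing_localization_ne_zero_of_newPrime`. [cite: MilneADT2006, Ch. I, Cor. 3.4] -/
theorem annLeft_invWeilPairing_kummerSelmerStructure_le_canonical (hk : k ≠ 0) (v : HeightOneSpectrum (𝓞 K))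
    (hpv : (p : 𝓞 K) ∉ v.asIdeal) :
    annLeft (invWeilPairing W (p ^ k) e hμ hadd₁ hadd₂ hgal (LocalInvariants.canonical K (p ^ k)) (Sum.inr v))
        (W.kummerSelmerStructure ((p ^ k : ℕ) : ℤ) (Sum.inr v)) ≤
      W.kummerSelmerStructure ((p ^ k : ℕ) : ℤ) (Sum.inr v) :=
  (annLeft_invWeilPairing_kummerSelmerStructure_eq_canonical W e hμ hadd₁ hadd₂ hgal halt hnondeg hk v hpv).le

end Summit.BirchSwinnertonDyer.BirchSwinnertonDyer.Theorems.GenusExact.RelaxedCount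

end
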